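import Summits.Ventures.CertifiedArithmetic.LowPrec.DoubleRoundingFMALadderIff
import Summits.Ventures.CertifiedArithmetic.LowPrec.DoubleRoundingFMABinadeCoarse

/-!
# Double rounding of the FMA — every binade above `W` (THEOREM D-fma-M∞): rung zero and the
# kernel instances

HONEST FRAMING: certified error envelopes and provably optimal rounding/accumulation schemes for
low-precision formats under stated cost models; every table by two implementations; no hardware
or vendor claims.

`fmaLadderTest m n i J` (`DoubleRoundingFMALadder.lean`) decides `DFma` for a source maximum
`(2^m + J)·2^(k+i+1)` quanta on the middle columns (`dFma_ladder_iff`).  §1: its binade `i = 0` IS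
THEOREM D-fma-M♯'s `fmaBinadeSlipTest m n J` (`fmaLadderTest_zero_eq`; more generally a
rung-zero candidate of any binade is a binade candidate below a larger `J'`,
`fmaBinadeSlipTest_of_rung_zero`), so the first-binade instances transfer (`(12, 23)`: threshold
`(i, J) = (0, 2)`).  §2: the kernel table `m ≤ 3` (threshold `(0, 1)`: the test is
`1 ≤ i ∨ 1 ≤ J`), and THE SECOND EXCEPTION `(m, n) = (16, 31)` (`P_X = 17`, `P_Y = 48`): no slip
for a source maximum up to `2W = 2^17·2^(k+1)` quanta (`fmaLadder_16_31_one_zero`, from the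
`J`-independent coarse criterion `fmaBinadeSlip_16_31` — binade `1` is invisible below `2W`), a slip
as soon as the maximum reaches `2W + 4h` (`fmaLadder_16_31_one_one`: `65535·65537 = 2^32 - 1`,
the universal cap of THEOREM N-fma-M∞ at `2m - n = 1`).  So the exact `DFma` threshold of a
`17`-digit source through a `48`-digit register is `M_φ = 2W`: the first column whose threshold
lies beyond the first binade.  Implementation A (`code/enum/fma_ladder_law.py`, structured residue
enumeration + brute force + the Lean test verbatim; `certs/enum/DOUBLE-ROUNDING-FMA-LADDER.json`)
tabulates the least passing `(i, J)` for `m ≤ 20`: `(0, 1)` everywhere except `(12, 23) ↦ (0, 2)`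
and `(16, 31) ↦ (1, 1)`.  No hardware or vendor claims.
-/

namespace Summit.Ventures.CertifiedArithmetic

/-! ## §1 Rung zero is the binade test -/

/-- A rung-zero candidate (`i' = g = 0`) of the ladder test below `(2^m + J)·2^(i+1)` is a
candidate of the binade test below `2·(2^m + J')` whenever `(2^m + J)·2^(i+1) ≤ 2·(2^m + J')`.
[this packet] -/
theorem fmaBinadeSlipTest_of_rung_zero {m n i J J' j d₁ : ℕ} {e : ℤ}
    (he : |e| ≤ 2 ^ (2 * m + 2 - n)) (htop : (2 ^ m + J) * 2 ^ (i + 1) ≤ (2 ^ m + J') * 2)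
    (hc : fmaLadderCond m n i J 0 j 0 d₁ e = true) : fmaBinadeSlipTest m n J' = true := by
  simp only [fmaLadderCond, Bool.and_eq_true, decide_eq_true_eq, pow_zero, mul_one,
    add_zero] at hc
  obtain ⟨⟨⟨⟨⟨⟨hv, hw1⟩, hw2⟩, hsh⟩, hd1o⟩, hd1g⟩, hsig⟩ := hc
  have hd : d₁ = 1 := by omega
  subst hd
  have htopz : ((2 : ℤ) ^ m + J) * 2 ^ (i + 1) ≤ (2 ^ m + J') * 2 := by exact_mod_cast htop
  have h2 : (2 : ℤ) ^ (m + 1) = 2 ^ m * 2 := pow_succ 2 m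
  refine fmaBinadeSlipTest_eq_true_of (j := j) (e := e) (by omega) he ?_
  simp only [fmaBinadeCond, Bool.and_eq_true, Bool.or_eq_true, decide_eq_true_eq]
  refine ⟨⟨⟨hw1, by rw [h2]; linarith⟩, ?_⟩, ?_⟩
  · simp only [fmaShape, Bool.or_eq_true, Bool.and_eq_true, decide_eq_true_eq] at hsh
    rcases hsh with (h0 | ⟨h0, -⟩) | h0
    · exact Or.inl h0
    · exact Or.inr h0
    · exact Or.inr (by omega)
  · simpa using hsig

/-- Conversely a binade candidate below `2·(2^m + J)`, `J ≤ 2^m`, is a rung-zero candidate of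
binade `0`. [this packet] -/
theorem fmaLadderTest_zero_of_binade {m n J : ℕ} (hJ : J ≤ 2 ^ m)
    (h : fmaBinadeSlipTest m n J = true) : fmaLadderTest m n 0 J = true := by
  unfold fmaBinadeSlipTest at h
  obtain ⟨j, hjm, h⟩ := List.any_eq_true.mp h
  rw [List.mem_range] at hjm
  obtain ⟨u, hum, hc⟩ := List.any_eq_true.mp h
  rw [List.mem_range] at hum
  simp only [fmaBinadeCond, Bool.and_eq_true, Bool.or_eq_true, decide_eq_true_eq] at hc
  obtain ⟨⟨⟨hw1, hw2⟩, hw3⟩, hsig⟩ := hc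
  have hu' : (u : ℤ) < 2 * (2:ℤ) ^ (2 * m + 2 - n) + 1 := by exact_mod_cast hum
  have h0u : (0 : ℤ) ≤ u := by positivity
  refine fmaLadderTest_eq_true_of (i' := 0) (j := j) (g := 0) (d₁ := 1)
    (e := (u : ℤ) - 2 ^ (2 * m + 2 - n)) le_rfl (by omega) le_rfl (by norm_num)
    (by rw [Nat.sub_zero, abs_le]; constructor <;> linarith) ?_
  have hJz : (J : ℤ) ≤ 2 ^ m := by exact_mod_cast hJ
  have h4 : (2 : ℤ) ^ (m + 2) = 2 ^ m * 4 := by rw [pow_add]; norm_num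
  have h2 : (2 : ℤ) ^ (m + 1) = 2 ^ m * 2 := by rw [pow_succ]
  simp only [fmaLadderCond, Bool.and_eq_true, decide_eq_true_eq, pow_zero, mul_one, add_zero,
    zero_add, pow_one]
  refine ⟨⟨⟨⟨⟨⟨by omega, hw1⟩, by linarith⟩, ?_⟩, by decide⟩, le_rfl⟩, by simpa using hsig⟩
  simp only [fmaShape, Bool.or_eq_true, Bool.and_eq_true, decide_eq_true_eq]
  rcases hw3 with h0 | h0
  · exact Or.inl (Or.inl h0)
  · rcases lt_or_ge (2 * ((2:ℤ) ^ m + j) + 1 - ((u : ℤ) - 2 ^ (2 * m + 2 - n))) (2 ^ (m + 2))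
      with h5 | h5
    · exact Or.inl (Or.inr ⟨h0, h5⟩)
    · right
      have h6 : 2 * ((2:ℤ) ^ m + j) + 1 - ((u : ℤ) - 2 ^ (2 * m + 2 - n)) = 2 ^ m * 4 := by
        linarith
      rw [h6]; exact Int.mul_emod_left _ _

/-- RUNG ZERO: `fmaLadderTest m n 0 J = fmaBinadeSlipTest m n J` for `J ≤ 2^m` — the first
binade of the ladder is THEOREM D-fma-M♯. [this packet] -/
theorem fmaLadderTest_zero_eq {m n J : ℕ} (hJ : J ≤ 2 ^ m) :
    fmaLadderTest m n 0 J = fmaBinadeSlipTest m n J := by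
  rcases hB : fmaBinadeSlipTest m n J with _ | _
  · by_contra hL
    have hL' : fmaLadderTest m n 0 J = true := by simpa using hL
    obtain ⟨i', j, g, d₁, e, hi', -, hg, -, he, hc⟩ := exists_of_fmaLadderTest hL'
    obtain rfl : i' = 0 := by omega
    obtain rfl : g = 0 := by omega
    have := fmaBinadeSlipTest_of_rung_zero (J' := J) (by simpa using he) (by omega) hc
    rw [hB] at this
    exact Bool.false_ne_true this
  · exact fmaLadderTest_zero_of_binade hJ hB

/-- AT `M = W` EXACTLY (`i = J = 0`) no midpoint is visible: the test fails (and `DFma` holds,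
THEOREM D-fma-M). [this packet] -/
theorem fmaLadderTest_zero_zero (m n : ℕ) : fmaLadderTest m n 0 0 = false := by
  by_contra hL
  obtain ⟨i', j, g, d₁, e, hi', -, -, -, -, hc⟩ := exists_of_fmaLadderTest (by simpa using hL)
  obtain rfl : i' = 0 := by omega
  simp only [fmaLadderCond, Bool.and_eq_true, decide_eq_true_eq, pow_zero, mul_one,
    add_zero] at hc
  have := hc.1.1.1.1.1.1
  rw [zero_add, pow_one] at this
  omega

/-! ## §2 The kernel instances -/

set_option synthInstance.maxSize 1024 in
/-- THE SMALL TABLE: on every middle column with `m ≤ 3` the least passing `(i, J)` is `(0, 1)`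
— the test is `1 ≤ i || 1 ≤ J` for `i ≤ 2`, `J ≤ 2^m` (implementation A: `(0, 1)` on every middle
column with `m ≤ 20` except `(12, 23)` and `(16, 31)`). [this packet] -/
theorem fmaLadder_small_table :
    ∀ m < 4, ∀ n < 2 * m + 1, ∀ i < 3, ∀ J < 2 ^ m + 1, 1 ≤ m → m + 2 ≤ n →
      fmaLadderTest m n i J = (decide (1 ≤ i) || decide (1 ≤ J)) := by
  decide +kernel

/-- THE FIRST EXCEPTION transfers: `(m, n) = (12, 23)` has no slip below `W + 2h` in binade `0`
(`fmaBinadeSlip_12_23_one`) … [this packet] -/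
theorem fmaLadder_12_23_zero_one : fmaLadderTest 12 23 0 1 = false := by
  rw [fmaLadderTest_zero_eq (by norm_num)]; exact fmaBinadeSlip_12_23_one

/-- … and slips below `W + 4h` (`fmaBinadeSlip_12_23_two`): threshold `(i, J) = (0, 2)`.
[this packet] -/
theorem fmaLadder_12_23_zero_two : fmaLadderTest 12 23 0 2 = true := by
  rw [fmaLadderTest_zero_eq (by norm_num)]; exact fmaBinadeSlip_12_23_two

/-- THE SECOND EXCEPTION, lower half: a `17`-digit source through a `48`-digit register with
largest value `2W = 2^17·2^(k+1)` quanta (`(i, J) = (1, 0)`) has NO slip: binade `1` is invisible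
below `2W`, and a rung-zero candidate would be a binade candidate below `2·(2^16 + 2^16)`,
excluded by the coarse criterion `fmaBinadeSlip_16_31` (`2^31 + 1 = 3·715827883`,
`3·2^31 - 1 = 13·19·26083777`, `2^32 - 1 = 65535·65537`). [this packet] -/
theorem fmaLadder_16_31_one_zero : fmaLadderTest 16 31 1 0 = false := by
  by_contra hL
  obtain ⟨i', j, g, d₁, e, hi', hj, hg, hd, he, hc⟩ := exists_of_fmaLadderTest (by simpa using hL)
  rcases Nat.le_one_iff_eq_zero_or_eq_one.mp hi' with rfl | rfl
  · obtain rfl : g = 0 := by omega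
    have := fmaBinadeSlipTest_of_rung_zero (J' := 2 ^ 16) (by simpa using he) (by norm_num) hc
    rw [fmaBinadeSlip_16_31] at this
    exact Bool.false_ne_true this
  · simp only [fmaLadderCond, Bool.and_eq_true, decide_eq_true_eq] at hc
    have := hc.1.1.1.1.1.1
    norm_num at this
    omega

/-- THE SECOND EXCEPTION, upper half: with largest value `2W + 4h = (2^16 + 1)·2^(k+2)` quanta
(`(i, J) = (1, 1)`) the FMA slips — the universal cap at `2m - n = 1` (candidate
`(i', j, g, d₁, e) = (1, 0, 1, 1, -1)`, `2^32 - 1 = 65535·65537`): `a = -(2^16 - 1)·quantum φ`,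
`b = (2^16 + 1)·quantum φ`, `c = (2^17 + 2)·2^(k+1)` quanta, whose exact sum lies one `quantum φ²`
ABOVE the midpoint `(2^17 + 1)·2^(k+1)` quanta of binade `1`, strictly inside the register's
half-spacing `2·quantum φ²` there.  So the exact `DFma` threshold at `(P_X, P_Y) = (17, 48)` is
`M_φ = 2W`. [this packet] -/
theorem fmaLadder_16_31_one_one : fmaLadderTest 16 31 1 1 = true := by
  refine fmaLadderTest_eq_true_of (i' := 1) (j := 0) (g := 1) (d₁ := 1) (e := -1) le_rfl
    (by norm_num) le_rfl (by norm_num) (by norm_num) ?_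
  have hsig : twoSigTest (16 + 1) ((-1 : ℤ) * 2 ^ (31 + 1) + ((1 : ℕ) : ℤ)).natAbs = true := by
    have e1 : ((-1 : ℤ) * 2 ^ (31 + 1) + ((1 : ℕ) : ℤ)).natAbs = 65535 * 65537 := by norm_num
    rw [e1]; exact twoSigTest_mul_eq_true (by norm_num) (by norm_num) (by norm_num)
  simp only [fmaLadderCond, Bool.and_eq_true, decide_eq_true_eq, Nat.zero_mod, if_true,
    Nat.cast_zero, add_zero]
  refine ⟨⟨⟨⟨⟨⟨by norm_num, by norm_num⟩, by norm_num⟩, by decide⟩, by decide⟩, by norm_num⟩, ?_⟩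
  simpa using hsig

end Summit.Ventures.CertifiedArithmetic
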